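import Mathlib

/-!
# Crux `MatrixDescartes` (stmt-ValiantsHypothesis-18050), line `Lift` — registered stub `stub_arith4`

In the crux's regime the matrix size `n` is quasi-polynomial in the number of terms `K`:
`n ≤ 2^((⌊log₂ K⌋ + c)^c)`.  This stub absorbs `n^q` into the budget `2^(K ⌊log₂ K⌋)` for all
large `K`:

`∃ K₁, ∀ K n, K₁ ≤ K → n ≤ 2 ^ ((Nat.log 2 K + c) ^ c) → n ^ q ≤ 2 ^ (K * Nat.log 2 K)`.

Proof.  Put `L := ⌊log₂ K⌋`.  Since `n^q ≤ 2^(q (L + c)^c)`, it suffices that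
`q (L + c)^c ≤ K L`.  As `2^L ≤ K` (`Nat.pow_log_le_self`) and `L ≥ 1` once `K ≥ 2`, it suffices
that `q (L + c)^c ≤ 2^L` for all large `L` (polynomial versus exponential,
`StubArith4.poly_le_two_pow`).  The latter is proved WITHOUT analysis, from the binomial bound
`m^(c+1) ≤ (m + c).descFactorial (c + 1) = (c+1)! * (m + c).choose (c + 1) ≤ (c+1)! * 2^(m + c)`
(`Nat.pow_sub_le_descFactorial`, `Nat.descFactorial_eq_factorial_mul_choose`,
`Nat.choose_le_two_pow`): with `m := L + c` and `M := (c+1)! 4^c` this reads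
`(L + c) (L + c)^c ≤ M 2^L`, so for `L ≥ q M` we get `q M (L + c)^c ≤ M 2^L` and cancel `M`.

Elementary; Mathlib only (axioms `propext`, `Classical.choice`, `Quot.sound`).
-/

-- layout Summits/ValiantsHypothesis/ValiantsHypothesis forces the duplicated namespace component
set_option linter.dupNamespace false

namespace Summit.ValiantsHypothesis.ValiantsHypothesis.Theorems.LacunarySymmetroidMatrixDescartes

namespace StubArith4

/-- Binomial bound: `m^(c+1) ≤ (c+1)! · 2^(m+c)`, via
`m^(c+1) ≤ (m+c)^(c+1 falling) = (c+1)! · C(m+c, c+1) ≤ (c+1)! · 2^(m+c)`. -/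
theorem pow_succ_le_factorial_mul_two_pow (m c : ℕ) :
    m ^ (c + 1) ≤ (c + 1).factorial * 2 ^ (m + c) := by
  have h1 : m ^ (c + 1) ≤ (m + c).descFactorial (c + 1) := by
    have h := Nat.pow_sub_le_descFactorial (m + c) (c + 1)
    have e : m + c + 1 - (c + 1) = m := by omega
    rwa [e] at h
  calc m ^ (c + 1) ≤ (m + c).descFactorial (c + 1) := h1
    _ = (c + 1).factorial * (m + c).choose (c + 1) :=
        Nat.descFactorial_eq_factorial_mul_choose _ _
    _ ≤ (c + 1).factorial * 2 ^ (m + c) := Nat.mul_le_mul_left _ (Nat.choose_le_two_pow _ _)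

/-- Polynomial versus exponential, in `ℕ`: for every `c q` there is `L₁` with
`q (L + c)^c ≤ 2^L` for all `L ≥ L₁` (one admissible threshold: `L₁ = q (c+1)! 4^c`). -/
theorem poly_le_two_pow (c q : ℕ) : ∃ L₁ : ℕ, ∀ L : ℕ, L₁ ≤ L → q * (L + c) ^ c ≤ 2 ^ L := by
  set M := (c + 1).factorial * 2 ^ (c + c) with hM
  have hMpos : 0 < M := by positivity
  refine ⟨q * M, fun L hL => ?_⟩
  have hA := pow_succ_le_factorial_mul_two_pow (L + c) c
  have key : M * (q * (L + c) ^ c) ≤ M * 2 ^ L :=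
    calc M * (q * (L + c) ^ c) = (q * M) * (L + c) ^ c := by ring
      _ ≤ (L + c) * (L + c) ^ c := Nat.mul_le_mul_right _ (by omega)
      _ = (L + c) ^ (c + 1) := (pow_succ' _ _).symm
      _ ≤ (c + 1).factorial * 2 ^ (L + c + c) := hA
      _ = M * 2 ^ L := by rw [hM]; ring
  exact Nat.le_of_mul_le_mul_left key hMpos

/-- The exponent comparison: for `K ≥ 2^(L₁+1)` (with `L₁` from `poly_le_two_pow`),
`q (⌊log₂ K⌋ + c)^c ≤ K ⌊log₂ K⌋`. -/
theorem exp_le (c q : ℕ) : ∃ K₁ : ℕ, ∀ K : ℕ, K₁ ≤ K →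
    q * (Nat.log 2 K + c) ^ c ≤ K * Nat.log 2 K := by
  obtain ⟨L₁, hL₁⟩ := poly_le_two_pow c q
  refine ⟨2 ^ (L₁ + 1), fun K hK => ?_⟩
  have hK0 : K ≠ 0 := by
    have := Nat.one_le_two_pow (n := L₁ + 1)
    omega
  have hL : L₁ + 1 ≤ Nat.log 2 K := Nat.le_log_of_pow_le one_lt_two hK
  have h2L : 2 ^ Nat.log 2 K ≤ K := Nat.pow_log_le_self 2 hK0
  calc q * (Nat.log 2 K + c) ^ c ≤ 2 ^ Nat.log 2 K := hL₁ _ (by omega)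
    _ ≤ K := h2L
    _ = K * 1 := (mul_one K).symm
    _ ≤ K * Nat.log 2 K := Nat.mul_le_mul_left K (by omega)

end StubArith4

/-- **Registered stub `stub_arith4`**: in the quasi-polynomial regime
`n ≤ 2^((⌊log₂ K⌋ + c)^c)`, the power `n^q` fits under the budget `2^(K ⌊log₂ K⌋)` for all
`K ≥ K₁(c, q)`. -/
theorem stub_arith4 (c q : ℕ) : ∃ K₁ : ℕ, ∀ K n : ℕ, K₁ ≤ K →
    n ≤ 2 ^ ((Nat.log 2 K + c) ^ c) → n ^ q ≤ 2 ^ (K * Nat.log 2 K) := by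
  obtain ⟨K₁, hK₁⟩ := StubArith4.exp_le c q
  refine ⟨K₁, fun K n hK hn => ?_⟩
  calc n ^ q ≤ (2 ^ ((Nat.log 2 K + c) ^ c)) ^ q := Nat.pow_le_pow_left hn q
    _ = 2 ^ (q * (Nat.log 2 K + c) ^ c) := (pow_mul' 2 q _).symm
    _ ≤ 2 ^ (K * Nat.log 2 K) := Nat.pow_le_pow_right (by norm_num) (hK₁ K hK)

end Summit.ValiantsHypothesis.ValiantsHypothesis.Theorems.LacunarySymmetroidMatrixDescartes
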